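import Summits.Ventures.CertifiedArithmetic.Expansions.Orient2dEstimate
import Mathlib.Tactic.Linarith
import Mathlib.Tactic.Positivity
import Mathlib.Tactic.Ring
import Mathlib.Tactic.NormNum

/-!
# When is `estimate` ZERO on a TWO-TWO-DIFF block? (the tails-zero exit of `orient2dadapt`, continued)

NEW WORK (Ventures; no published counterpart claimed).  `Orient2dEstimate.lean` proved that on a
nonoverlapping block `[b₀, b₁, b₂, b₃]` of floats whose top pair is one TWO-SUM (`fl (b₃ + b₂) = b₃`)
the value `estimate = ((b₀ ⊕ b₁) ⊕ b₂) ⊕ b₃` is zero or has the sign of the sum, and left open whether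
`predicates.c`'s `orient2dadapt` can return `det = estimate(4, B) = 0` at its "all four tails zero"
exit for a NONZERO determinant (a wrong "collinear").  This file reduces that question to one rigid
configuration and bounds the damage:

* `ulp_le_half_abs` — a float-format fact: for `p ≥ 2`, `ulp(b) > 2^emin` forces `ulp(b) ≤ |b|/2`.
* `estimate_four_eq_zero` — **if `estimate = 0` then `b₂ = 0` and `b₀ ⊕ b₁ = −b₃`** (`p ≥ 2`, any
  round-to-nearest, gradual underflow included).  Proof: `Q₂ ⊕ b₃ = 0` forces `Q₂ = −b₃` (floats);
  if `b₂ ≠ 0` then `|Q₂| ≤ 2|b₂| ≤ ulp(b₃)` while `|b₂| ≥ 2^emin` makes `ulp(b₃) ≥ 2^(emin+1)`, so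
  `b₃` is normal and `ulp(b₃) ≤ |b₃|/2 < |b₃| = |Q₂|` — impossible; hence `b₂ = 0` and `Q₂ = b₀ ⊕ b₁`.
* `abs_sum_le_of_estimate_four_eq_zero` — consequently **`|b₀ + b₁ + b₂ + b₃| ≤ ulp(b₃)/2`**: a zero
  estimate can only hide a sum below half an ulp of the block's leading component (the sum is then
  the roundoff of `b₀ + b₁`).
* `twoTwoDiff_estimate_eq_zero`, `orient2d_tailsZero_eq_zero` — the same for the TWO-TWO-DIFF block
  and for `orient2dadapt`: if the coordinate differences are floats and the returned `det` is `0`, the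
  block is `[B₀, B₁, 0, B₃]` with `B₀ ⊕ B₁ = −B₃` and the TRUE determinant satisfies
  `|t_A| ≤ ulp(B₃)/2`.

WHAT REMAINS OPEN, precisely: can `B₀ ⊕ B₁ = −B₃ ≠ 0` happen for
`B = TWO-TWO-DIFF(TWO-PRODUCT(x₁, x₂), TWO-PRODUCT(x₃, x₄))` with `x₅ = x₁ ⊗ x₂`, `x₆ = x₃ ⊗ x₄` nonzero
of one sign (stage A fell through)?  Here `B₃ = _j + _l` exactly (`B₂ = 0`), `_j = x₅ ⊕ _i`,
`_i = a₀ ⊖ b₀` (two-product tails), `_l = _0 ⊖ x₆`, `B₁ = (_0 − x₆) − _l`, `B₀ = (a₀ − b₀) − _i`, and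
`|_0| ≤ ulp(_j)/2`, `|B₁| ≤ ulp(_l)/2`, `|B₀| ≤ ulp(_i)/2`.  A hand analysis (NOT formalised; signs,
ties and the subnormal range need care) runs: `|B₃| = |B₀ ⊕ B₁| ≤ ulp(_l)/2·(1 + O(ε))` and `B₃ ≠ 0`
is a multiple of `min(ulp(_j), ulp(_l))`, forcing `ulp(_j) = ulp(_l)/2`, `|_l| = 2^E` (a binade
boundary), `|_j| = 2^E − u` with `u = 2^(E−p)`, `|B₃| = u`, `x₆ ∈ {2^E − u, 2^E}`, `B₁ ∈ {_0, ±u/2}`;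
then `B₀ ⊕ B₁ = ∓u` needs `|B₀| ≥ u(1/2 − 2^(−p−1))` against `|B₀| ≤ ulp(_i)/2 ≤ 2u·2^(−p)` —
impossible for `p ≥ 3`.  So the exit is believed never to return a wrong `0`, but this file proves
only the reduction.  EVIDENCE (exact rational model
`work/est0_search.py`, exhaustive over all pairs of products `P = x₁x₂`, `Q = x₃x₄` of `p`-bit floats
with `Q/P ∈ (1 − 8ε, 1 + 8ε)`, `Q ≠ P`, three relative binades, no underflow): `p = 4`: 65 149 pairs,
`p = 5`: 453 878 pairs — `estimate(B) = 0` never occurs with `Σ B ≠ 0` (and no sign violation).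

References: J. R. Shewchuk, Discrete Comput. Geom. 18 (1997) 305–363, §2.7, §2.8, §4.3 Fig. 21 and
`predicates.c` (`estimate`, `orient2dadapt`) [Shewchuk1997].
-/

namespace Summit.Ventures.CertifiedArithmetic.Expansions

open Literature.ComputerArithmetic.JeannerodRump2018
open Literature.ComputerArithmetic.BoldoJeannerodMelquiondMuller2023 hiding twoSum twoSum_fst isFloat_twoSum
open Literature.ComputerArithmetic.JoldesMullerPopescu2017 (isFloat_two_zpow abs_fl_le_of_abs_le)
open Literature.ComputerArithmetic.Shewchuk1997

variable {p : ℕ} {emin : ℤ} {fl : ℚ → ℚ}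

/-! ## A format fact -/

/-- For `p ≥ 2`: if `ulp(b)` exceeds the minimal quantum `2^emin` then `b` is a normal number and
`ulp(b) ≤ |b| / 2` (in general `ulp(b) ≤ |b| / 2^(p−1)`). -/
theorem ulp_le_half_abs (hp : 2 ≤ p) {b : ℚ} (hb : (2 : ℚ) ^ emin < ulp p emin b) :
    ulp p emin b ≤ |b| / 2 := by
  have hp1 : 1 ≤ p := le_trans (by norm_num) hp
  have hnormal : (2 : ℚ) ^ (emin + p - 1) ≤ |b| := by
    by_contra hlt
    rw [not_le] at hlt
    rw [ulp_eq_of_abs_lt hlt] at hb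
    exact lt_irrefl _ hb
  have h := ulp_le_of_normal hp1 hnormal
  have h2 : (2 : ℚ) ≤ 2 ^ (p - 1) := by
    calc (2 : ℚ) = 2 ^ 1 := by norm_num
      _ ≤ 2 ^ (p - 1) := pow_le_pow_right₀ (by norm_num) (by omega)
  calc ulp p emin b ≤ |b| / 2 ^ (p - 1) := h
    _ ≤ |b| / 2 := div_le_div_of_nonneg_left (abs_nonneg b) (by norm_num) h2

/-! ## `estimate = 0` on a four-component block with a TWO-SUM top pair -/

/-- **A ZERO ESTIMATE IS RIGID.** On a nonoverlapping block of floats `[b₀, b₁, b₂, b₃]` (smallest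
first) whose top pair is one TWO-SUM (`fl (b₃ + b₂) = b₃`), `estimate = 0` forces `b₂ = 0` and
`b₀ ⊕ b₁ = −b₃`.  Any round-to-nearest, `p ≥ 2`, gradual underflow included. -/
theorem estimate_four_eq_zero (hp : 2 ≤ p) (hfl : IsRoundNearest p emin fl) {b₀ b₁ b₂ b₃ : ℚ}
    (h₀ : IsFloat p emin b₀) (h₁ : IsFloat p emin b₁) (h₂ : IsFloat p emin b₂)
    (h₃ : IsFloat p emin b₃) (hexp : IsExpansion 1 [b₀, b₁, b₂, b₃]) (htop : fl (b₃ + b₂) = b₃)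
    (hz : estimate fl [b₀, b₁, b₂, b₃] = 0) : b₂ = 0 ∧ fl (b₀ + b₁) = -b₃ := by
  have hp1 : 1 ≤ p := le_trans (by norm_num) hp
  rw [estimate_four] at hz
  -- the pairwise gap conditions we need
  have hpw := hexp
  simp only [IsExpansion, List.pairwise_cons, List.mem_cons, List.mem_nil_iff, or_false,
    forall_eq_or_imp, forall_eq, List.Pairwise.nil, and_true] at hpw
  obtain ⟨⟨h01, h02, -⟩, ⟨h12, -⟩, -⟩ := hpw
  have hQ1F : IsFloat p emin (fl (b₀ + b₁)) := (hfl _).1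
  have hQ2F : IsFloat p emin (fl (fl (b₀ + b₁) + b₂)) := (hfl _).1
  -- the last rounding is of a grid point, so it vanishes only if its argument does
  have hQ2 : fl (fl (b₀ + b₁) + b₂) = -b₃ := by
    have hg : OnGrid emin (fl (fl (b₀ + b₁) + b₂) + b₃) :=
      (OnGrid.of_isFloat hQ2F).add (OnGrid.of_isFloat h₃)
    have h0 := (fl_eq_zero_iff_of_onGrid hp1 hfl le_rfl hg).mp hz
    linarith
  by_cases hb2 : b₂ = 0
  · refine ⟨hb2, ?_⟩
    rw [hb2, add_zero, fl_eq_self hfl hQ1F] at hQ2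
    exact hQ2
  · exfalso
    -- `|Q₂| ≤ ulp(b₃)` as in the sign lemma
    have hQ1 : |fl (b₀ + b₁)| ≤ |b₂| := (abs_fl_add_le_of_below hp1 hfl h₀ h₁ h₂ hb2 h01 h02 h12).2
    have hhalf : |b₂| ≤ ulp p emin b₃ / 2 := by
      have h := abs_sub_fl_le_half_ulp_fl hp1 hfl (b₃ + b₂)
      rwa [htop, add_sub_cancel_left] at h
    have hin : |fl (b₀ + b₁) + b₂| ≤ ulp p emin b₃ := (abs_add_le _ _).trans (by linarith)
    have hQ2le : |fl (fl (b₀ + b₁) + b₂)| ≤ ulp p emin b₃ :=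
      abs_fl_le_of_abs_le hfl (isFloat_ulp hp1 b₃) hin
    rw [hQ2, abs_neg] at hQ2le
    -- but `b₂ ≠ 0` is at least `2^emin`, so `ulp(b₃) ≥ 2^(emin+1)` and `b₃` is normal: `ulp(b₃) ≤ |b₃|/2`
    have hb2ge : (2 : ℚ) ^ emin ≤ |b₂| := (OnGrid.of_isFloat h₂).two_zpow_le_abs hb2
    have hulp : (2 : ℚ) ^ emin < ulp p emin b₃ := by
      have h2pos : (0 : ℚ) < 2 ^ emin := zpow_pos (by norm_num) _
      linarith
    have h := ulp_le_half_abs hp hulp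
    have hb3 : |b₃| ≤ 0 := by linarith
    have hb30 : b₃ = 0 := abs_eq_zero.mp (le_antisymm hb3 (abs_nonneg _))
    rw [hb30, ulp_zero] at hulp
    exact lt_irrefl _ hulp

/-- **A ZERO ESTIMATE HIDES AT MOST HALF AN ULP.** Under the hypotheses of `estimate_four_eq_zero`,
`estimate = 0` implies `|b₀ + b₁ + b₂ + b₃| ≤ ulp(b₃) / 2` (the sum is the roundoff of `b₀ + b₁`,
whose rounding is `−b₃`). -/
theorem abs_sum_le_of_estimate_four_eq_zero (hp : 2 ≤ p) (hfl : IsRoundNearest p emin fl)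
    {b₀ b₁ b₂ b₃ : ℚ} (h₀ : IsFloat p emin b₀) (h₁ : IsFloat p emin b₁) (h₂ : IsFloat p emin b₂)
    (h₃ : IsFloat p emin b₃) (hexp : IsExpansion 1 [b₀, b₁, b₂, b₃]) (htop : fl (b₃ + b₂) = b₃)
    (hz : estimate fl [b₀, b₁, b₂, b₃] = 0) : |b₀ + b₁ + b₂ + b₃| ≤ ulp p emin b₃ / 2 := by
  have hp1 : 1 ≤ p := le_trans (by norm_num) hp
  obtain ⟨hb2, hQ1⟩ := estimate_four_eq_zero hp hfl h₀ h₁ h₂ h₃ hexp htop hz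
  have h := abs_sub_fl_le_half_ulp_fl hp1 hfl (b₀ + b₁)
  rw [hQ1, ulp_neg] at h
  have hsum : b₀ + b₁ + b₂ + b₃ = b₀ + b₁ - -b₃ := by rw [hb2]; ring
  rwa [hsum]

/-! ## The TWO-TWO-DIFF block and `orient2dadapt` -/

/-- **ZERO ESTIMATE ON A TWO-TWO-DIFF BLOCK.** If the block `TWO-TWO-DIFF((a₁,a₀), (b₁,b₀))` is
nonoverlapping and its `estimate` is `0`, then it has the form `[B₀, B₁, 0, B₃]` with `B₀ ⊕ B₁ = −B₃`
and its (exact) sum satisfies `|Σ| ≤ ulp(B₃)/2` (`p ≥ 2`, any round-to-nearest). -/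
theorem twoTwoDiff_estimate_eq_zero (hp : 2 ≤ p) (hfl : IsRoundNearest p emin fl) {a₁ a₀ b₁ b₀ : ℚ}
    (hexp : IsExpansion 1 (twoTwoDiff fl a₁ a₀ b₁ b₀))
    (hz : estimate fl (twoTwoDiff fl a₁ a₀ b₁ b₀) = 0) :
    ∃ B₀ B₁ B₃ : ℚ, twoTwoDiff fl a₁ a₀ b₁ b₀ = [B₀, B₁, 0, B₃] ∧ fl (B₀ + B₁) = -B₃ ∧
      IsFloat p emin B₀ ∧ IsFloat p emin B₁ ∧ IsFloat p emin B₃ ∧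
      |(twoTwoDiff fl a₁ a₀ b₁ b₀).sum| ≤ ulp p emin B₃ / 2 := by
  have hp1 : 1 ≤ p := le_trans (by norm_num) hp
  rw [twoTwoDiff_eq] at hexp hz ⊢
  have hT1 := isFloat_twoSum hfl (-b₀) a₀
  have hT2 := isFloat_twoSum hfl (twoSum fl (-b₀) a₀).1 a₁
  have hT3 := isFloat_twoSum hfl (-b₁) (twoSum fl (twoSum fl (-b₀) a₀).1 a₁).2
  have hT4 := isFloat_twoSum hfl (twoSum fl (-b₁) (twoSum fl (twoSum fl (-b₀) a₀).1 a₁).2).1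
    (twoSum fl (twoSum fl (-b₀) a₀).1 a₁).1
  have htop := (twoSum_exact hp1 hfl hT3.1 hT2.1).2
  have htop' : fl ((twoSum fl (twoSum fl (-b₁) (twoSum fl (twoSum fl (-b₀) a₀).1 a₁).2).1
      (twoSum fl (twoSum fl (-b₀) a₀).1 a₁).1).1 +
      (twoSum fl (twoSum fl (-b₁) (twoSum fl (twoSum fl (-b₀) a₀).1 a₁).2).1
      (twoSum fl (twoSum fl (-b₀) a₀).1 a₁).1).2) =
      (twoSum fl (twoSum fl (-b₁) (twoSum fl (twoSum fl (-b₀) a₀).1 a₁).2).1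
      (twoSum fl (twoSum fl (-b₀) a₀).1 a₁).1).1 := by
    rw [htop]; rfl
  obtain ⟨hb2, hQ1⟩ := estimate_four_eq_zero hp hfl hT1.2 hT3.2 hT4.2 hT4.1 hexp htop' hz
  have hsum := abs_sum_le_of_estimate_four_eq_zero hp hfl hT1.2 hT3.2 hT4.2 hT4.1 hexp htop' hz
  refine ⟨_, _, _, by rw [hb2], hQ1, hT1.2, hT3.2, hT4.1, ?_⟩
  simpa [List.sum_cons, add_assoc] using hsum

/-- **THE TAILS-ZERO EXIT: A RETURNED ZERO IS RIGID AND NEARLY RIGHT.** If the four coordinate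
differences are floats (so `orient2dadapt` returns `det = estimate(4, B)` right after stage B) and
`det = 0`, then — with `B₃` the leading component of the block, a float — the block is `[B₀, B₁, 0, B₃]`
with `B₀ ⊕ B₁ = −B₃`, and the TRUE determinant satisfies `|t_A| ≤ ulp(B₃)/2`.  (`p ≥ 2`, any
round-to-nearest with the `RoundoffBelow 2` property, error-free two-products.)  Whether `t_A ≠ 0` is
possible here at all is open — see the module docstring. -/
theorem orient2d_tailsZero_eq_zero (hp : 2 ≤ p) (hfl : IsRoundNearest p emin fl)
    (hfl2 : RoundoffBelow 2 fl) {tp : ℚ → ℚ → ℚ × ℚ} {a₁ a₂ b₁ b₂ c₁ c₂ : ℚ}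
    (h₁ : IsFloat p emin (a₁ - c₁)) (h₂ : IsFloat p emin (b₂ - c₂)) (h₃ : IsFloat p emin (a₂ - c₂))
    (h₄ : IsFloat p emin (b₁ - c₁)) (h₁₂ : ExactTwoProd p emin fl tp (a₁ - c₁) (b₂ - c₂))
    (h₃₄ : ExactTwoProd p emin fl tp (a₂ - c₂) (b₁ - c₁))
    (hz : orient2dDetB tp fl a₁ a₂ b₁ b₂ c₁ c₂ = 0) :
    ∃ B₀ B₁ B₃ : ℚ,
      twoTwoProdDiff tp fl (a₁ - c₁) (b₂ - c₂) (a₂ - c₂) (b₁ - c₁) = [B₀, B₁, 0, B₃] ∧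
      fl (B₀ + B₁) = -B₃ ∧ IsFloat p emin B₃ ∧
      |(a₁ - c₁) * (b₂ - c₂) - (a₂ - c₂) * (b₁ - c₁)| ≤ ulp p emin B₃ / 2 := by
  have hp1 : 1 ≤ p := le_trans (by norm_num) hp
  unfold orient2dDetB at hz
  rw [fl_eq_self hfl h₁, fl_eq_self hfl h₂, fl_eq_self hfl h₃, fl_eq_self hfl h₄] at hz
  obtain ⟨hW, hS, -, -⟩ := twoTwoProdDiff_spec hp1 hfl hfl2 h₁₂ h₃₄
  rw [← hS]
  unfold twoTwoProdDiff at hW hz ⊢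
  obtain ⟨B₀, B₁, B₃, hB, hQ, -, -, hF₃, hsum⟩ :=
    twoTwoDiff_estimate_eq_zero hp hfl hW.isExpansion hz
  exact ⟨B₀, B₁, B₃, hB, hQ, hF₃, hsum⟩

end Summit.Ventures.CertifiedArithmetic.Expansions
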